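import Summits.Ventures.PercRepro.ProfilePointedCircuitClassesPairSevenA

/-!
# PercRepro — THE PER-PAIR IN–OUT INEQUALITY AT `n = 12`, II: THE DEFICIENT DEMANDS (p5, gen 42;
`proofs/P5-GM1.md` §64)

A deficient demand `W` (at most three non-coloops in `B := E ∖ W`) has EXACTLY three non-coloops forming a parallel
class `P` (removing the coloops one by one drops the rank by one each: `ρ(P) + #K = 5`, `#K ≥ 4`, and a loopless
set of rank `0` is empty), so `B = K ⊔ P` with `#K = 4` and `ρ(K + p) = 5`.  Its three disjoint units are the sets
`B − p`, `p ∈ P`; the circuit of `E ∖ (B − p) = W + p` is `p + cw(W)` with `cw(W) := {w ∈ W : ρ(W − w + p) = 5}`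
(independent of `p ∈ P` by parallel substitution), so `p(B − p) = m + 1` with `m := #(cw(W) ∖ S)`, and the three
weights are `12 / (m + 1)` — or `3` when `cw(W)` is a single point outside `S`.  When the three disjoint units do
not reach `12` (`m = 3`, or the `(2,0)` case `m = 1`), pick `w ∈ cw(W) ∖ S`: the three sets `V_p := K + p + w` are
CLEAN `(2,0)`-units (`E ∖ V_p = (W − w) + (P − p)` has the parallel pair `P − p` as its circuit) of weight `1`, and
`3·3 + 3 = 12` (`twelve_le_sum_pwt_of_deficient`).
-/

open scoped Matroid

namespace PercRepro.Cogirth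

open Finset ThmH Skew Shadow Profile

variable {α : Type} [DecidableEq α] {M : Matroid α} [M.Finite]

section PairSevenB

/-- A coloop of `B` is a coloop of every subset of `B` containing it. -/
theorem rk_erase_add_one_of_coloop {B X : Finset α} (hB : B ⊆ gr M) (hXB : X ⊆ B) {b : α} (hbX : b ∈ X)
    (hco : rk M (B.erase b) + 1 = rk M B) : rk M (X.erase b) + 1 = rk M X := by
  have h := rk_union_add_rk_inter_le (M := M) X (B.erase b)
  have hu : X ∪ B.erase b = B := by
    ext a
    simp only [mem_union, mem_erase]
    constructor
    · rintro (h | ⟨_, h⟩)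
      · exact hXB h
      · exact h
    · intro h
      by_cases hab : a = b
      · exact Or.inl (hab ▸ hbX)
      · exact Or.inr ⟨hab, h⟩
  have hi : X ∩ B.erase b = X.erase b := by
    ext a
    simp only [mem_inter, mem_erase]
    constructor
    · rintro ⟨h1, h2, _⟩
      exact ⟨h2, h1⟩
    · rintro ⟨h1, h2⟩
      exact ⟨h2, h1, hXB h2⟩
  rw [hu, hi] at h
  have h2 := rk_le_rk_erase_add_one (M := M) (hXB.trans hB) hbX
  omega

/-- Removing a set `K'` of coloops of `B` drops the rank by `#K'`. -/
theorem rk_sdiff_add_card_eq_of_forall_coloop {B : Finset α} (hB : B ⊆ gr M) {K : Finset α} (hK : K ⊆ B)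
    (hco : ∀ b ∈ K, rk M (B.erase b) + 1 = rk M B) :
    ∀ K' : Finset α, K' ⊆ K → rk M (B \ K') + K'.card = rk M B := by
  intro K'
  induction K' using Finset.induction_on with
  | empty => intro _; simp
  | @insert b K' hbK' ih =>
    intro hsub
    have hbK : b ∈ K := hsub (mem_insert_self _ _)
    have hK'K : K' ⊆ K := (subset_insert _ _).trans hsub
    have ih' := ih hK'K
    have hbB : b ∈ B \ K' := mem_sdiff.2 ⟨hK hbK, hbK'⟩
    have e : B \ insert b K' = (B \ K').erase b := by
      ext a
      simp only [mem_sdiff, mem_insert, mem_erase, not_or]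
      tauto
    have h := rk_erase_add_one_of_coloop hB sdiff_subset hbB (hco b hbK)
    rw [e, card_insert_of_notMem hbK']
    omega

/-- `E ∖ (B − b) = W + b` for `B = E ∖ W`, `b ∈ B`. -/
theorem sdiff_erase_sdiff_eq_insert {W : Finset α} (hW : W ⊆ gr M) {b : α} (hb : b ∈ gr M \ W) :
    gr M \ (gr M \ W).erase b = insert b W := by
  ext a
  rw [mem_sdiff, mem_erase, mem_sdiff, mem_insert]
  constructor
  · rintro ⟨hag, h⟩
    by_cases hab : a = b
    · exact Or.inl hab
    · exact Or.inr (by_contra fun haW => h ⟨hab, hag, haW⟩)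
  · rintro (rfl | haW)
    · exact ⟨(mem_sdiff.1 hb).1, fun h => h.1 rfl⟩
    · exact ⟨hW haW, fun h => h.2.2 haW⟩

/-- **THE STRUCTURE OF A DEFICIENT DEMAND**: `nonco(W)` has exactly three points and rank `1`. -/
theorem nonco_card_eq_three_of_deficient (hn : (gr M).card = 12) (hll : ∀ x ∈ gr M, rk M {x} = 1)
    {S W : Finset α} (hW : W ∈ pdem M S) (hd : deficient M W) :
    (nonco M W).card = 3 ∧ rk M (nonco M W) = 1 := by
  obtain ⟨hWg, hW5, _, _, hWc⟩ := mem_pdem.1 hW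
  have hBg : gr M \ W ⊆ gr M := sdiff_subset
  have hB7 : (gr M \ W).card = 7 := by rw [card_sdiff_of_subset hWg, hn, hW5]
  have hncB : nonco M W ⊆ gr M \ W := filter_subset _ _
  have hco : ∀ b ∈ (gr M \ W) \ nonco M W, rk M ((gr M \ W).erase b) + 1 = rk M (gr M \ W) := by
    intro b hb
    rw [mem_sdiff] at hb
    have hnot : ¬ rk M ((gr M \ W).erase b) = 5 := fun h => hb.2 (by unfold nonco; exact mem_filter.2 ⟨hb.1, h⟩)
    have h1 := rk_le_rk_erase_add_one (M := M) hBg hb.1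
    have h2 := rk_mono' (M := M) (erase_subset b (gr M \ W))
    omega
  have hK := rk_sdiff_add_card_eq_of_forall_coloop hBg sdiff_subset hco ((gr M \ W) \ nonco M W) (Subset.refl _)
  rw [Finset.sdiff_sdiff_eq_self hncB, card_sdiff_of_subset hncB, hB7, hWc] at hK
  have hd' : (nonco M W).card ≤ 3 := hd
  rcases (nonco M W).eq_empty_or_nonempty with hne | ⟨x, hx⟩
  · rw [hne, card_empty] at hK
    omega
  · have h1 : 1 ≤ rk M (nonco M W) := by
      have := rk_mono' (M := M) (singleton_subset_iff.2 hx)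
      rw [hll x (hBg (hncB hx))] at this
      exact this
    have h3 := card_le_card hncB
    omega

/-- The points of `nonco(W)` are pairwise parallel (`ρ ≤ 1` on every pair). -/
theorem rk_pair_le_one_of_mem_nonco (hn : (gr M).card = 12) (hll : ∀ x ∈ gr M, rk M {x} = 1)
    {S W : Finset α} (hW : W ∈ pdem M S) (hd : deficient M W) {p q : α} (hp : p ∈ nonco M W)
    (hq : q ∈ nonco M W) : rk M {p, q} ≤ 1 := by
  have h := (nonco_card_eq_three_of_deficient hn hll hW hd).2
  have hsub : ({p, q} : Finset α) ⊆ nonco M W := insert_subset hp (singleton_subset_iff.2 hq)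
  have := rk_mono' (M := M) hsub
  omega

/-- `ρ(K + p) = 5` for `p ∈ nonco(W)`, `K := B ∖ nonco(W)` (the class collapses to one point). -/
theorem rk_insert_sdiff_nonco_eq_five (hn : (gr M).card = 12) (hll : ∀ x ∈ gr M, rk M {x} = 1)
    {S W : Finset α} (hW : W ∈ pdem M S) (hd : deficient M W) {p : α} (hp : p ∈ nonco M W) :
    rk M (insert p ((gr M \ W) \ nonco M W)) = 5 := by
  have hWc := (mem_pdem.1 hW).2.2.2.2
  have hncB : nonco M W ⊆ gr M \ W := filter_subset _ _
  have hBg : gr M \ W ⊆ gr M := sdiff_subset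
  have h := rk_union_eq_rk_insert_of_parallel_class hll (P := nonco M W) (F := (gr M \ W) \ nonco M W)
    (hncB.trans hBg) ((sdiff_subset (s := gr M \ W) (t := nonco M W)).trans hBg) hp
    (le_of_eq (nonco_card_eq_three_of_deficient hn hll hW hd).2)
  rw [sdiff_union_of_subset hncB] at h
  rw [← h, hWc]

/-- `cw(W, p)`: the points `w ∈ W` with `W − w + p` spanning. -/
noncomputable def cw (M : Matroid α) [M.Finite] (W : Finset α) (p : α) : Finset α :=
  W.filter (fun w => rk M (insert p (W.erase w)) = 5)

/-- `cw(W, p) = cw(W, q)` for parallel `p, q`. -/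
theorem cw_eq_of_parallel (hll : ∀ x ∈ gr M, rk M {x} = 1) {W : Finset α} (hW : W ⊆ gr M) {p q : α}
    (hp : p ∈ gr M) (hq : q ∈ gr M) (hpq : rk M {p, q} ≤ 1) : cw M W p = cw M W q := by
  unfold cw
  apply filter_congr
  intro w _
  rw [rk_insert_eq_of_parallel hll hp hq hpq ((erase_subset _ _).trans hW)]

/-- The circuit of `W + p` for a basis `W ∌ p`: `p` together with `cw(W, p)`. -/
theorem circ5_insert_eq {W : Finset α} (hWr : rk M W = 5) {p : α} (hpW : p ∉ W) :
    circ5 M (insert p W) = insert p (cw M W p) := by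
  ext t
  rw [mem_circ5, mem_insert]
  unfold cw
  rw [mem_insert, mem_filter]
  constructor
  · rintro ⟨ht, hr⟩
    rcases ht with rfl | htW
    · exact Or.inl rfl
    · right
      refine ⟨htW, ?_⟩
      rwa [erase_insert_of_ne (fun h => hpW (by rw [h]; exact htW))] at hr
  · rintro (rfl | ⟨htW, hr⟩)
    · refine ⟨Or.inl rfl, ?_⟩
      rw [erase_insert hpW]
      exact hWr
    · refine ⟨Or.inr htW, ?_⟩
      rw [erase_insert_of_ne (fun h => hpW (by rw [h]; exact htW))]
      exact hr

/-- The weight of the disjoint unit `B − p` of a deficient demand: `3` when `cw(W, p)` is a single point outside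
`S`, else `12 / (#(cw(W, p) ∖ S) + 1)`. -/
theorem pwt_erase_eq {S W : Finset α} (hW : W ∈ pdem M S) {p : α} (hp : p ∈ nonco M W) :
    pwt M S W ((gr M \ W).erase p) =
      (if (cw M W p).card = 1 ∧ cw M W p ∩ S = ∅ then 3 else 12 / ((cw M W p \ S).card + 1)) := by
  obtain ⟨hWg, hW5, hSW, hWr, _⟩ := mem_pdem.1 hW
  have hpB : p ∈ gr M \ W := by unfold nonco at hp; exact (mem_filter.1 hp).1
  have hpW : p ∉ W := (mem_sdiff.1 hpB).2
  have hpS : p ∉ S := fun h => hpW (hSW h)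
  have hpcw : p ∉ cw M W p := fun h => hpW (filter_subset _ _ h)
  have hWU : W ∩ (gr M \ W).erase p = ∅ :=
    disjoint_iff_inter_eq_empty.1 (disjoint_of_subset_right (erase_subset _ _) sdiff_disjoint.symm)
  unfold pwt
  rw [if_pos hWU]
  have hZ : gr M \ (gr M \ W).erase p = insert p W := sdiff_erase_sdiff_eq_insert hWg hpB
  have hc : circ5 M (gr M \ (gr M \ W).erase p) = insert p (cw M W p) := by
    rw [hZ, circ5_insert_eq hWr hpW]
  have ht : type20 M S ((gr M \ W).erase p) ↔ ((cw M W p).card = 1 ∧ cw M W p ∩ S = ∅) := by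
    unfold type20
    rw [hc, card_insert_of_notMem hpcw]
    constructor
    · rintro ⟨h1, h2⟩
      refine ⟨by omega, ?_⟩
      rw [← subset_empty, ← h2]
      exact inter_subset_inter (subset_insert _ _) (Subset.refl _)
    · rintro ⟨h1, h2⟩
      refine ⟨by omega, ?_⟩
      rw [insert_inter_of_notMem hpS, h2]
  have hpU : pU M S ((gr M \ W).erase p) = (cw M W p \ S).card + 1 := by
    unfold pU
    rw [hc, insert_sdiff_of_notMem _ hpS, card_insert_of_notMem (fun h => hpcw (mem_sdiff.1 h).1)]
  by_cases h20 : (cw M W p).card = 1 ∧ cw M W p ∩ S = ∅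
  · rw [if_pos (ht.2 h20), if_pos h20]
  · rw [if_neg (fun h => h20 (ht.1 h)), if_neg h20, hpU]

/-- The clean unit `V := K + p + w` of a deficient demand (`w ∈ cw(W, p) ∖ S`): a `(2,0)`-unit with
`W ∩ V = {w}`, `B ∖ V = nonco(W) − p` its circuit, hence weight `1`. -/
theorem clean_unit_facts (hn : (gr M).card = 12) (hR : rk M (gr M) = 5) (hll : ∀ x ∈ gr M, rk M {x} = 1)
    {S W : Finset α} (hW : W ∈ pdem M S) (hd : deficient M W) {p : α} (hp : p ∈ nonco M W)
    {w : α} (hw : w ∈ cw M W p \ S) :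
    insert w (insert p ((gr M \ W) \ nonco M W)) ∈ punit M S ∧
      pwt M S W (insert w (insert p ((gr M \ W) \ nonco M W))) = 1 := by
  obtain ⟨hWg, hW5, hSW, hWr, hWc⟩ := mem_pdem.1 hW
  obtain ⟨hc3, hr1⟩ := nonco_card_eq_three_of_deficient hn hll hW hd
  have hBg : gr M \ W ⊆ gr M := sdiff_subset
  have hB7 : (gr M \ W).card = 7 := by rw [card_sdiff_of_subset hWg, hn, hW5]
  have hncB : nonco M W ⊆ gr M \ W := filter_subset _ _
  have hK4 : ((gr M \ W) \ nonco M W).card = 4 := by rw [card_sdiff_of_subset hncB, hB7, hc3]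
  have hpB : p ∈ gr M \ W := hncB hp
  have hpg : p ∈ gr M := hBg hpB
  have hpW : p ∉ W := (mem_sdiff.1 hpB).2
  have hpS : p ∉ S := fun h => hpW (hSW h)
  have hpK : p ∉ (gr M \ W) \ nonco M W := fun h => (mem_sdiff.1 h).2 hp
  rw [mem_sdiff] at hw
  obtain ⟨hwcw, hwS⟩ := hw
  have hwW : w ∈ W := by unfold cw at hwcw; exact (mem_filter.1 hwcw).1
  have hwr : rk M (insert p (W.erase w)) = 5 := by unfold cw at hwcw; exact (mem_filter.1 hwcw).2
  have hwg : w ∈ gr M := hWg hwW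
  have hwB : w ∉ gr M \ W := fun h => (mem_sdiff.1 h).2 hwW
  have hwK : w ∉ insert p ((gr M \ W) \ nonco M W) := by
    rw [mem_insert]
    rintro (rfl | h)
    · exact hpW hwW
    · exact hwB (mem_sdiff.1 h).1
  have hKg : (gr M \ W) \ nonco M W ⊆ gr M := sdiff_subset.trans hBg
  -- the two other points of the class
  have hQ2 : ((nonco M W).erase p).card = 2 := by rw [card_erase_of_mem hp, hc3]
  obtain ⟨q, q', hqq', hQ⟩ := card_eq_two.1 hQ2
  have hqQ : q ∈ (nonco M W).erase p := by rw [hQ]; exact mem_insert_self _ _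
  have hq'Q : q' ∈ (nonco M W).erase p := by rw [hQ]; exact mem_insert_of_mem (mem_singleton_self _)
  have hqn : q ∈ nonco M W := (mem_erase.1 hqQ).2
  have hq'n : q' ∈ nonco M W := (mem_erase.1 hq'Q).2
  have hqp : q ≠ p := (mem_erase.1 hqQ).1
  have hq'p : q' ≠ p := (mem_erase.1 hq'Q).1
  have hqg : q ∈ gr M := hBg (hncB hqn)
  have hq'g : q' ∈ gr M := hBg (hncB hq'n)
  have hqW : q ∉ W := (mem_sdiff.1 (hncB hqn)).2
  have hq'W : q' ∉ W := (mem_sdiff.1 (hncB hq'n)).2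
  have hpq : rk M {p, q} ≤ 1 := rk_pair_le_one_of_mem_nonco hn hll hW hd hp hqn
  have hpq' : rk M {p, q'} ≤ 1 := rk_pair_le_one_of_mem_nonco hn hll hW hd hp hq'n
  have hqq'r : rk M {q, q'} ≤ 1 := rk_pair_le_one_of_mem_nonco hn hll hW hd hqn hq'n
  -- the complement `Z = E ∖ V = (W − w) + q + q'`
  have hZ : gr M \ insert w (insert p ((gr M \ W) \ nonco M W)) = insert q (insert q' (W.erase w)) := by
    ext a
    simp only [mem_sdiff, mem_insert, mem_erase, not_or, not_and, not_not]
    constructor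
    · rintro ⟨hag, haw, hap, h⟩
      by_cases haW : a ∈ W
      · exact Or.inr (Or.inr ⟨haw, haW⟩)
      · have han : a ∈ nonco M W := h ⟨hag, haW⟩
        have : a ∈ (nonco M W).erase p := mem_erase.2 ⟨hap, han⟩
        rw [hQ, mem_insert, mem_singleton] at this
        rcases this with rfl | rfl
        · exact Or.inl rfl
        · exact Or.inr (Or.inl rfl)
    · rintro (rfl | rfl | ⟨haw, haW⟩)
      · exact ⟨hqg, fun h => hqW (by rw [h]; exact hwW), hqp, fun _ => hqn⟩
      · exact ⟨hq'g, fun h => hq'W (by rw [h]; exact hwW), hq'p, fun _ => hq'n⟩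
      · exact ⟨hWg haW, haw, fun h => hpW (h ▸ haW), fun h => absurd haW h.2⟩
  have hWe : W.erase w ⊆ gr M := (erase_subset _ _).trans hWg
  -- `ρ(Z) = ρ(W − w + q) = ρ(W − w + p) = 5`
  have hZr : rk M (insert q (insert q' (W.erase w))) = 5 := by
    rw [rk_insert_insert_eq_of_parallel hll hq'g hqq'r, rk_insert_eq_of_parallel hll hq'g hpg
      (by rw [pair_comm]; exact hpq') hWe, hwr]
  -- `V` is a unit
  have hVg : insert w (insert p ((gr M \ W) \ nonco M W)) ⊆ gr M :=
    insert_subset hwg (insert_subset hpg hKg)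
  have hVr : rk M (insert w (insert p ((gr M \ W) \ nonco M W))) = 5 := by
    have h1 := rk_mono' (M := M) (subset_insert w (insert p ((gr M \ W) \ nonco M W)))
    have h2 := rk_mono' (M := M) hVg
    rw [rk_insert_sdiff_nonco_eq_five hn hll hW hd hp] at h1
    omega
  have hV : insert w (insert p ((gr M \ W) \ nonco M W)) ∈ punit M S := by
    rw [mem_punit]
    refine ⟨hVg, ?_, ?_, hVr, by rw [hZ, hZr]⟩
    · rw [card_insert_of_notMem hwK, card_insert_of_notMem hpK, hK4]
    · rw [← disjoint_iff_inter_eq_empty]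
      rw [disjoint_insert_left]
      refine ⟨hwS, ?_⟩
      rw [disjoint_insert_left]
      refine ⟨hpS, ?_⟩
      exact disjoint_of_subset_left (sdiff_subset.trans (Subset.refl _))
        (disjoint_of_subset_right hSW sdiff_disjoint)
  refine ⟨hV, ?_⟩
  -- the weight: `W ∩ V = {w}`, `B ∖ V = {q, q'} = circ5(Z)`, a `(2,0)`-unit, `W` deficient
  have hWV : W ∩ insert w (insert p ((gr M \ W) \ nonco M W)) = {w} := by
    ext a
    simp only [mem_inter, mem_insert, mem_singleton, mem_sdiff]
    constructor
    · rintro ⟨haW, rfl | rfl | ⟨⟨_, h⟩, _⟩⟩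
      · rfl
      · exact absurd haW hpW
      · exact absurd haW h
    · rintro rfl
      exact ⟨hwW, Or.inl rfl⟩
  have hBV : (gr M \ W) \ insert w (insert p ((gr M \ W) \ nonco M W)) = {q, q'} := by
    rw [← hQ]
    ext a
    simp only [mem_sdiff, mem_insert, mem_erase, not_or, not_and, not_not]
    constructor
    · rintro ⟨⟨hag, haW⟩, _, hap, h⟩
      exact ⟨hap, h ⟨hag, haW⟩⟩
    · rintro ⟨hap, han⟩
      have haB := hncB han
      exact ⟨mem_sdiff.1 haB, fun h => hwB (by rw [← h]; exact haB), hap, fun _ => han⟩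
  have hcirc : circ5 M (gr M \ insert w (insert p ((gr M \ W) \ nonco M W))) = {q, q'} := by
    rw [hZ]
    ext t
    rw [mem_circ5]
    simp only [mem_insert, mem_singleton]
    constructor
    · rintro ⟨ht, hr⟩
      rcases ht with rfl | rfl | htW
      · exact Or.inl rfl
      · exact Or.inr rfl
      · -- a point of `W − w`: removing it leaves `(W − w − t) + q + q'` of rank `≤ 4`
        exfalso
        have hne1 : q ≠ t := fun h => hqW (h ▸ (mem_erase.1 htW).2)
        have hne2 : q' ≠ t := fun h => hq'W (h ▸ (mem_erase.1 htW).2)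
        rw [erase_insert_of_ne hne1, erase_insert_of_ne hne2,
          rk_insert_insert_eq_of_parallel hll hq'g hqq'r] at hr
        have h1 := rk_insert_le (M := M) q' ((W.erase w).erase t)
        have h2 := rk_le_card (M := M) ((W.erase w).erase t)
        rw [card_erase_of_mem htW, card_erase_of_mem hwW, hW5] at h2
        omega
    · rintro (rfl | rfl)
      · refine ⟨Or.inl rfl, ?_⟩
        rw [erase_insert (by rw [mem_insert, mem_erase]; rintro (h | ⟨_, h⟩); exact hqq' h; exact hqW h),
          rk_insert_eq_of_parallel hll hq'g hpg (by rw [pair_comm]; exact hpq') hWe, hwr]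
      · refine ⟨Or.inr (Or.inl rfl), ?_⟩
        rw [erase_insert_of_ne hqq', erase_insert (by rw [mem_erase]; rintro ⟨_, h⟩; exact hq'W h),
          rk_insert_eq_of_parallel hll hqg hpg (by rw [pair_comm]; exact hpq) hWe, hwr]
  have hqS : q ∉ S := fun h => hqW (hSW h)
  have hq'S : q' ∉ S := fun h => hq'W (hSW h)
  unfold pwt
  rw [if_neg (by rw [hWV]; exact singleton_ne_empty w)]
  rw [if_pos]
  refine ⟨by rw [hWV, card_singleton], by rw [hBV, hcirc], ⟨?_, ?_⟩, hd⟩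
  · rw [hcirc, card_pair hqq']
  · rw [hcirc, ← disjoint_iff_inter_eq_empty, disjoint_insert_left, disjoint_singleton_left]
    exact ⟨hqS, hq'S⟩

end PairSevenB

end PercRepro.Cogirth
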